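import Summits.BirchSwinnertonDyer.BirchSwinnertonDyer.Theorems.AlignedTransportAtTwoMainConjectureOfRankZeroBSDAtTwoFineRoadKleinCountingLambdaSplit
import HarnessLib

/-!
# Route `AlignedTransportAtTwo`, crux C2 `MainConjectureOfRankZeroBSDAtTwo` (stmt-BirchSwinnertonDyer-22298),
# road (b″): PERFECT DESCENT at `2`, part XIII — the TRANSFER FORMALISM for the `e₁`-part:
# `res ∘ Ver = 3`, `Ver ∘ res = 1 + σ + σ²` ⟹ `(1 + σ + σ²)X = Ver(A) ≅ A`, so `μ(e₁X) = μ(A)`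

Cell `bsd-f1-sign2`, WIDTH-5 attach seat `bsd-line-att-p3` (gen 5) on line `birth` of crux C2
(`--supports` stmt-BirchSwinnertonDyer-22298; closes nothing). HONEST FRAMING: THEOREMS ONLY — no definition, no
named fact, no instance, no `sorry`; BSD is NOT proved by any of this. Sequel of part XI (`…KleinCountingLambdaSplit`),
whose counting lemma takes «`ℓ₍₂₎((1 + σ + σ²)X) = 0`» as its only external input. PERFECT-DESCENT.md §3 (iv) obtains that
input as «`e₁X(F_∞) = (1 + σ + σ²)X(F_∞) = j(N_{F/K}(X(F_∞))) ⊆ j(X(K_∞))`, a homomorphic image of `X(K_∞)`, and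
`μ(X(K_∞)) = 0` (Ferrero–Washington, `K = ℚ(√Δ_E)` abelian)»; the lead's CENSUS-lead-g5 (A3) sharpens it to
«`X^{C₃} = i(X(K_∞))` EXACTLY (`N ∘ i = 3 ∈ ℤ₂ˣ`)». This file is the module-theoretic content of that sentence: for
Galois groups of abelian extensions, restriction `res : X(F_∞) → X(K_∞)` and transfer `Ver : X(K_∞) → X(F_∞)` satisfy
`res ∘ Ver = [F_∞ : K_∞] = 3` and `Ver ∘ res = 1 + σ + σ²` (`Gal(F_∞/K_∞) = ⟨σ⟩`); from these two identities ALONE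
(any commutative ring with `3` a unit, any modules) `Ver` is injective with image `(1 + σ + σ²)X`.

## What is proved

* §1 (any commutative ring `R` with `3 ∈ Rˣ`; `R`-modules `A`, `X`; `X` with an `R`-linear `Q`-action; linear maps
  `i : A → X`, `nm : X → A` with `nm ∘ i = 3` and `i ∘ nm = 1 + σ + σ²`): **`injective_of_transfer`** (`i` injective),
  **`range_norm_eq_range_of_transfer`** (`(1 + σ + σ²)X = i(A)`), **`nonempty_linearEquiv_range_norm_of_transfer`**
  (`A ≅ (1 + σ + σ²)X`).
* §2 (`R = Λ = ℤ₂⟦T⟧`): **`lengthAt_range_norm_eq_of_transfer`** (`ℓ_𝔭((1 + σ + σ²)X) = ℓ_𝔭(A)` at every prime);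
  **`lengthAt_eq_of_transfer`** (`ℓ_𝔭(X) = ℓ_𝔭(A) + ℓ_𝔭(W)`, `W = ker(1 + σ + σ²)`); and the COUNTING LEMMA WITH THE
  FERRERO–WASHINGTON INPUT IN ITS NATIVE FORM: **`finite_equivariant_iff_isTorsion_and_muInvariant_eq_zero_S3_of_transfer`**
  / `…_of_no_transposition_of_transfer` — if `A` is `Λ`-torsion with `μ(A) = 0` then `Hom_Q(X, V₄)` is finite ⟺ `X` is
  `Λ`-torsion with `μ(X) = 0`.

Not here: that `(res, Ver)` on the (unconstructed) unramified Iwasawa modules satisfy the two identities (group theory of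
the transfer; Neukirch–Schmidt–Wingberg (1.5.9)) and Ferrero–Washington itself (tree fact
`ferreroWashington1979_classicalMuVanishes`) — typing.

References: J. Neukirch, A. Schmidt, K. Wingberg, *Cohomology of Number Fields*, (1.5.9) (`Ver ∘ res`, `res ∘ Ver`);
L. Washington, *Cyclotomic Fields*, §13.2; PERFECT-DESCENT.md §3 (iv); CENSUS-lead-g5.md §1 (A3).
-/

set_option autoImplicit false
-- the Theorems namespace of this sub repeats the summit name by design (D-0017 nested layout)
set_option linter.dupNamespace false

noncomputable section

namespace Summit.BirchSwinnertonDyer.BirchSwinnertonDyer.Theorems.AlignedTransportAtTwoFineRoad.PerfectDescent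

open Literature.NumberTheory.EllipticCurves Literature.NumberTheory.EllipticCurves.IwasawaAlgebra
  Literature.NumberTheory.EllipticCurves.Module

/-! ## §1 The transfer formalism: `nm ∘ i = 3`, `i ∘ nm = 1 + σ + σ²` -/

section Transfer

variable {Q : Type*} [Group Q] {R : Type*} [CommRing R]
  {A : Type*} [AddCommGroup A] [_root_.Module R A]
  {X : Type*} [AddCommGroup X] [_root_.Module R X] [DistribMulAction Q X] [SMulCommClass Q R X]

omit [SMulCommClass Q R X] in
/-- **`i` is injective** when `nm ∘ i = 3` and `3 ∈ Rˣ` (`Ver : X(K_∞) → X(F_∞)` is injective for the cubic `F/K` at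
`p = 2`). [cite: NeukirchSchmidtWingberg2008, Ch. I §5, (1.5.9)] -/
theorem injective_of_transfer (h3 : IsUnit (3 : R)) (i : A →ₗ[R] X) (nm : X →ₗ[R] A)
    (hni : ∀ a : A, nm (i a) = (3 : R) • a) : Function.Injective i := by
  obtain ⟨u, hu⟩ := h3.exists_left_inv
  rw [injective_iff_map_eq_zero]
  intro a ha
  have h := congrArg (fun x ↦ u • nm x) ha
  simp only [hni, smul_smul, hu, one_smul, map_zero, smul_zero] at h
  exact h

/-- **`(1 + σ + σ²)X = i(A)`** when `nm ∘ i = 3 ∈ Rˣ` and `i ∘ nm = 1 + σ + σ²`: `⊆` is `Nx = i(nm x)`; `⊇` is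
`i a = i(3⁻¹·nm(i a)) = N(i(3⁻¹a))`. This is «`X^{C₃} = i(X(K_∞))` exactly» of CENSUS-lead-g5 (A3) (with part XI
`range_norm_eq_fixed`: `(1 + σ + σ²)X = X^σ`). [cite: NeukirchSchmidtWingberg2008, Ch. I §5, (1.5.9)] -/
theorem range_norm_eq_range_of_transfer (h3 : IsUnit (3 : R)) {σ : Q} (i : A →ₗ[R] X) (nm : X →ₗ[R] A)
    (hni : ∀ a : A, nm (i a) = (3 : R) • a) (hin : ∀ x : X, i (nm x) = x + σ • x + σ • (σ • x)) :
    LinearMap.range (LinearMap.id + DistribSMul.toLinearMap R X σ + (DistribSMul.toLinearMap R X σ).comp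
        (DistribSMul.toLinearMap R X σ)) = LinearMap.range i := by
  obtain ⟨u, hu⟩ := h3.exists_left_inv
  ext x
  simp only [LinearMap.mem_range, LinearMap.add_apply, LinearMap.id_apply, LinearMap.comp_apply,
    DistribSMul.toLinearMap_apply]
  constructor
  · rintro ⟨y, rfl⟩
    exact ⟨nm y, hin y⟩
  · rintro ⟨a, rfl⟩
    refine ⟨i (u • a), ?_⟩
    rw [← hin, hni, smul_smul, mul_comm, hu, one_smul]

/-- **`A ≅ (1 + σ + σ²)X`** under the transfer identities (`i` injective onto `NX`): the `e₁`-part of `X` IS `A`.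
[cite: NeukirchSchmidtWingberg2008, Ch. I §5, (1.5.9)] -/
theorem nonempty_linearEquiv_range_norm_of_transfer (h3 : IsUnit (3 : R)) {σ : Q} (i : A →ₗ[R] X) (nm : X →ₗ[R] A)
    (hni : ∀ a : A, nm (i a) = (3 : R) • a) (hin : ∀ x : X, i (nm x) = x + σ • x + σ • (σ • x)) :
    Nonempty (A ≃ₗ[R] LinearMap.range (LinearMap.id + DistribSMul.toLinearMap R X σ +
      (DistribSMul.toLinearMap R X σ).comp (DistribSMul.toLinearMap R X σ))) :=
  ⟨(LinearEquiv.ofInjective i (injective_of_transfer h3 i nm hni)).trans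
    (LinearEquiv.ofEq _ _ (range_norm_eq_range_of_transfer h3 i nm hni hin).symm)⟩

end Transfer

/-! ## §2 Over `Λ = ℤ₂⟦T⟧`: `ℓ(NX) = ℓ(A)`, `ℓ(X) = ℓ(A) + ℓ(W)`, and the counting lemma with `μ(A) = 0` as input -/

section LambdaTransfer

variable {Q : Type*} [Group Q] {M : Type*} [AddCommGroup M] [DistribMulAction Q M]
  {A : Type*} [AddCommGroup A] [_root_.Module (IwasawaAlgebra 2) A]
  {X : Type*} [AddCommGroup X] [_root_.Module (IwasawaAlgebra 2) X] [DistribMulAction Q X]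
  [SMulCommClass Q (IwasawaAlgebra 2) X]

/-- **`ℓ_𝔭((1 + σ + σ²)X) = ℓ_𝔭(A)`** at every prime of `Λ = ℤ₂⟦T⟧`, under the transfer identities (`3 ∈ Λˣ`, part XI).
In the application: `μ(e₁X(F_∞)) = μ(X(K_∞))`. [cite: Washington1997, §13.2] -/
theorem lengthAt_range_norm_eq_of_transfer {σ : Q} (i : A →ₗ[IwasawaAlgebra 2] X) (nm : X →ₗ[IwasawaAlgebra 2] A)
    (hni : ∀ a : A, nm (i a) = (3 : IwasawaAlgebra 2) • a) (hin : ∀ x : X, i (nm x) = x + σ • x + σ • (σ • x))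
    (𝔭 : PrimeSpectrum (IwasawaAlgebra 2)) :
    lengthAt (IwasawaAlgebra 2) (LinearMap.range (LinearMap.id + DistribSMul.toLinearMap (IwasawaAlgebra 2) X σ +
      (DistribSMul.toLinearMap (IwasawaAlgebra 2) X σ).comp (DistribSMul.toLinearMap (IwasawaAlgebra 2) X σ))) 𝔭 =
      lengthAt (IwasawaAlgebra 2) A 𝔭 := by
  obtain ⟨e⟩ := nonempty_linearEquiv_range_norm_of_transfer isUnit_three_iwasawaAlgebra_two i nm hni hin
  exact (lengthAt_eq_of_linearEquiv e 𝔭).symm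

/-- **`ℓ_𝔭(X) = ℓ_𝔭(A) + ℓ_𝔭(W)`**, `W = ker(1 + σ + σ²)`, under the transfer identities and `σ³ = 1` (parts XI + XIII).
In the application: `μ(X(F_∞)) = μ(X(K_∞)) + μ((1 − e₁)X(F_∞))`. [cite: Washington1997, §13.2] -/
theorem lengthAt_eq_of_transfer {σ : Q} (hσ3 : ∀ x : X, σ • (σ • (σ • x)) = x)
    (i : A →ₗ[IwasawaAlgebra 2] X) (nm : X →ₗ[IwasawaAlgebra 2] A)
    (hni : ∀ a : A, nm (i a) = (3 : IwasawaAlgebra 2) • a) (hin : ∀ x : X, i (nm x) = x + σ • x + σ • (σ • x))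
    (𝔭 : PrimeSpectrum (IwasawaAlgebra 2)) :
    lengthAt (IwasawaAlgebra 2) X 𝔭 =
      lengthAt (IwasawaAlgebra 2) A 𝔭 +
        lengthAt (IwasawaAlgebra 2)
          (LinearMap.ker (LinearMap.id + DistribSMul.toLinearMap (IwasawaAlgebra 2) X σ +
            (DistribSMul.toLinearMap (IwasawaAlgebra 2) X σ).comp (DistribSMul.toLinearMap (IwasawaAlgebra 2) X σ))) 𝔭 := by
  rw [lengthAt_eq_lengthAt_range_norm_add (X := X) hσ3 𝔭, lengthAt_range_norm_eq_of_transfer i nm hni hin 𝔭]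

/-- **COUNTING LEMMA WITH THE FERRERO–WASHINGTON INPUT IN NATIVE FORM, `Q̄ = S₃`.** `Q` acts on the Klein four-group `M`
through `Aut(M) ≅ S₃` (`σ` fixed-point-free, `τ ≠ 1` fixing `m₀ ≠ 0`) and `Λ`-linearly on the finitely generated
`Λ = ℤ₂⟦T⟧`-module `X` (kernel acting trivially); `A` is a `Λ`-module with maps `i : A → X`, `nm : X → A`, `nm ∘ i = 3`,
`i ∘ nm = 1 + σ + σ²` (restriction / transfer). IF `A` is `Λ`-torsion with `μ(A) = 0` (in the application `A = X(K_∞)`,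
`K = ℚ(√Δ_E)`: Ferrero–Washington), THEN `Hom_Q(X, V₄)` is finite ⟺ `X` is `Λ`-torsion with `μ(X) = 0`.
[cite: SerreGaloisCohomology1997, I §5.1] [cite: Washington1997, §13.2] -/
theorem finite_equivariant_iff_isTorsion_and_muInvariant_eq_zero_S3_of_transfer
    [Module.Finite (IwasawaAlgebra 2) X] [Module.Finite (IwasawaAlgebra 2) A]
    (h4 : Nat.card M = 4) (h2 : ∀ m : M, m + m = 0) {σ τ : Q}
    {m₀ : M} (hσ : ∀ m : M, σ • m = m → m = 0) (hm₀ : m₀ ≠ 0) (hτ0 : τ • m₀ = m₀)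
    (hτ : ¬ ∀ m : M, τ • m = m) (hVN : ∀ g : Q, (∀ m : M, g • m = m) → ∀ x : X, g • x = x)
    (i : A →ₗ[IwasawaAlgebra 2] X) (nm : X →ₗ[IwasawaAlgebra 2] A)
    (hni : ∀ a : A, nm (i a) = (3 : IwasawaAlgebra 2) • a) (hin : ∀ x : X, i (nm x) = x + σ • x + σ • (σ • x))
    (hA : Module.IsTorsion (IwasawaAlgebra 2) A) (hμA : muInvariant 2 A = 0) :
    Finite {f : X →+ M // ∀ (g : Q) (x : X), f (g • x) = g • f x} ↔
      Module.IsTorsion (IwasawaAlgebra 2) X ∧ muInvariant 2 X = 0 := by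
  have hA0 := (lengthAt_augIdealP_eq_zero_iff_isTorsion_and_muInvariant_eq_zero 2 (Y := A)).mpr ⟨hA, hμA⟩
  refine finite_equivariant_iff_isTorsion_and_muInvariant_eq_zero_S3_of_norm h4 h2 hσ hm₀ hτ0 hτ hVN ?_
  rw [lengthAt_range_norm_eq_of_transfer i nm hni hin, hA0]

/-- **COUNTING LEMMA WITH THE FERRERO–WASHINGTON INPUT IN NATIVE FORM, `Q̄ = C₃`** (the case `G_∞ ≅ C₃`): as
`finite_equivariant_iff_isTorsion_and_muInvariant_eq_zero_S3_of_transfer` with no transposition.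
[cite: SerreGaloisCohomology1997, I §5.1] [cite: Washington1997, §13.2] -/
theorem finite_equivariant_iff_isTorsion_and_muInvariant_eq_zero_of_no_transposition_of_transfer
    [Module.Finite (IwasawaAlgebra 2) X] [Module.Finite (IwasawaAlgebra 2) A]
    (h4 : Nat.card M = 4) (h2 : ∀ m : M, m + m = 0) {σ : Q} (hσ : ∀ m : M, σ • m = m → m = 0)
    (hnoT : ∀ g : Q, (∀ m : M, g • m = m) ∨ (∀ m : M, g • m = m → m = 0))
    (hVN : ∀ g : Q, (∀ m : M, g • m = m) → ∀ x : X, g • x = x)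
    (i : A →ₗ[IwasawaAlgebra 2] X) (nm : X →ₗ[IwasawaAlgebra 2] A)
    (hni : ∀ a : A, nm (i a) = (3 : IwasawaAlgebra 2) • a) (hin : ∀ x : X, i (nm x) = x + σ • x + σ • (σ • x))
    (hA : Module.IsTorsion (IwasawaAlgebra 2) A) (hμA : muInvariant 2 A = 0) :
    Finite {f : X →+ M // ∀ (g : Q) (x : X), f (g • x) = g • f x} ↔
      Module.IsTorsion (IwasawaAlgebra 2) X ∧ muInvariant 2 X = 0 := by
  have hA0 := (lengthAt_augIdealP_eq_zero_iff_isTorsion_and_muInvariant_eq_zero 2 (Y := A)).mpr ⟨hA, hμA⟩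
  refine finite_equivariant_iff_isTorsion_and_muInvariant_eq_zero_of_no_transposition_of_norm h4 h2 hσ hnoT hVN ?_
  rw [lengthAt_range_norm_eq_of_transfer i nm hni hin, hA0]

end LambdaTransfer

end Summit.BirchSwinnertonDyer.BirchSwinnertonDyer.Theorems.AlignedTransportAtTwoFineRoad.PerfectDescent

end
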